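import Summits.AtomisticToContinuum.Crystallization.Theorems.FrustratedLawDichotomyStrainedPatchStretchRows

/-!
# Strained patch — TEXTURE PROFILES and the TEXTURE FLOOR (lens «finite range + asymptotic regime + bridge», g70)

Node 66R split the tube floor `(TF) TubeFloor 𝓘 τ` as (LOC∇ m) ∧ (FT∇ m): a relative-texture LAW `RelTexture 𝓘 τ m` (asymptotic-regime theorem) feeding a
texture-priced finite CERTIFICATE `RobustTubeCert 𝓘 τ m`; 67S localised it to an inner ball.  Both are PROVED at the a-priori value `m = 2τ` and carry
content only for `m < 2τ`; the census priced the rescue of the record kernel at `m⋆ ≈ 0.28 τ` (critic rows 1142/1156/1164: «(LOC∇ m) IDEA-NEEDED»).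

This node does three things (§3, added after census AUG-63 FINAL / critic row 1177, types the ℓ²-currency leaf `InteriorTexLaw` + the law-assisted
certificate + their SEAM and witness format — see the §3 header).

§1 **PROFILE FORMAT** [formal bookkeeping, PROVED]: the law and the certificate indexed by a radial texture profile `μ : ℝ → ℝ` (texture `≤ μ(dist(z a, z c))`
at reach site `a`), with the bridge `(LOC∇ μ) ∧ (FT∇ μ) ⟹ (TF)`, monotonicity in `μ`, the constant profile `=` 66R, the step profile `⟹` 67S, the a-priori
member `μ ≥ 2τ`, and the record junction `⟹ CoreOffTubeFloor (63/10) (63/10) (24/5) (1/100) 0` given `CoverP`.  This is the format in which the census's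
graded («dial») certificates and any depth-dependent texture law must meet.

§2 **TEXTURE FLOOR** [refutation format, PROVED bookkeeping + MEASURED instrument data]: `TextureWitness 𝓘 τ ρ m` — an admissible clean mono-phase
`τ`-charted cluster with a reach bond at depth `≤ ρ` of relative texture `> m` — refutes every law `RelTextureProfile 𝓘 τ μ` with `μ ≤ m` on `[0, ρ]`
(`not_relTextureProfile_of_witness`), in particular 66R's `RelTexture 𝓘 τ m` (`not_relTexture_of_witness`).  INSTRUMENT (seat files
`pub/decomp-a2c/decomp-a2c-lens-5/g70/work/{texprobe.py, nlwit.py, bloch.py}`, memo `g70/memo/NODE-g70.md`): on the record host HE52, ball `63/10`, `τ = 1/80`,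
identity chart, an exterior `±τ` push pattern relaxed to a force-free interior (`max ‖siteForce 7‖ ≤ σ₁/278`, every atom within `τ` of its chart point)
realises relative texture `0.606 τ` on the CENTRAL nearest-neighbour bond and `≈ 0.58–0.62 τ` uniformly on all nn bonds of midpoint radius `≤ 4`, rising to
`0.8–1.06 τ` at radius `4.5–6` (targeted bonds at radius 3.1 / 4.0 / 5.0: `0.81 / 0.87 / 1.03 τ`; R = 17/2: `0.445 τ` flat to radius 5, `0.70 τ` at 6.2); read with
the law's own quantifier (`b ∈ moveNbrs 7`: all neighbours within 7) the same witness has texture `1.28 τ` at the centre row and `1.88 τ` at depth 3–4.5.  The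
linear (lattice-Green's-function) adversary alone guarantees `0.32–0.81 × 2τ` (R = 63/10) and `0.26–0.49 × 2τ` (R = 17/2).
Hence — modulo the admissibility fine print of the witness class, which the census owns — (LOC∇ m) is FALSE for `m < 0.6 τ` (nn reading) resp. `m < 1.88 τ`
(as typed) at the record geometry, against the bar `m⋆ ≈ 0.28 τ`; and since the floor is produced by boundary data alone it persists, as a FRACTION of `2τ`,
at every `τ` and decays only slowly with the ball radius (`0.61 τ → 0.45 τ` from R = 63/10 to 17/2).  The texture rescue of the texture-priced certificate
is therefore closed.  What survives (memo §6): on these near-equilibrium fields the TRUE row remainder is `≤ 0.12 σ₁` (R = 63/10 row zone; `≤ 0.06 σ₁` at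
R = 17/2) while its texture price is `2–4 σ₁` — a collective cancellation over the neighbour shell by a factor `20–65` that no termwise (texture,
longitudinal/transverse, affine/non-affine) pricing sees; an adversary maximising one row's second-order charge over the linear-response image of the data
box reaches `0.3–0.9 σ₁` (box-scaled), i.e. the charge is of the order of the force cap, `150–500×` below the a-priori `2τ` price.  The successor leaf is a
certificate pricing that quadratic form directly («(SV) second variation on equilibrium fields»); its well-posedness prerequisite, monotonicity of the
secant operator on the `τ`-tube, holds by the termwise Bloch bound exactly for `τ ≲ 1/142` (`ν(1/160) = +0.068`, `ν(1/80) = −0.45` per nn bond; `bloch.py`).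

No `sorry`, no new axioms; every `theorem` here is bookkeeping over 66R/67S/HostCells declarations.
-/

namespace Summit.AtomisticToContinuum.Crystallization.Theorems.FrustratedLawDichotomyStrainedPatchTextureFloor

open scoped BigOperators Classical RealInnerProductSpace
open Summit.AtomisticToContinuum.Crystallization.Theorems.FrustratedLawDichotomyMotifLemmas
open Summit.AtomisticToContinuum.Crystallization.Theorems.FrustratedLawDichotomyAveragingCut
open Summit.AtomisticToContinuum.Crystallization.Theorems.FrustratedLawDichotomyStrainedPatchHomSplit
open Summit.AtomisticToContinuum.Crystallization.Theorems.FrustratedLawDichotomyStrainedPatchCleanCollar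
open Summit.AtomisticToContinuum.Crystallization.Theorems.FrustratedLawDichotomyStrainedPatchPhaseCut
open Summit.AtomisticToContinuum.Crystallization.Theorems.FrustratedLawDichotomyStrainedPatchCoreTube
open Summit.AtomisticToContinuum.Crystallization.Theorems.FrustratedLawDichotomyStrainedPatchAugmentedEnvelope
open Summit.AtomisticToContinuum.Crystallization.Theorems.FrustratedLawDichotomyStrainedPatchEnvelopeLaw
open Summit.AtomisticToContinuum.Crystallization.Theorems.FrustratedLawDichotomyStrainedPatchEnvelopeTaylor
open Summit.AtomisticToContinuum.Crystallization.Theorems.FrustratedLawDichotomyStrainedPatchChartFamilies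
open Summit.AtomisticToContinuum.Crystallization.Theorems.FrustratedLawDichotomyStrainedPatchQuantSlaving
open Summit.AtomisticToContinuum.Crystallization.Theorems.FrustratedLawDichotomyStrainedPatchHostCells
open Summit.AtomisticToContinuum.Crystallization.Theorems.FrustratedLawDichotomyStrainedPatchForceCap
open Summit.AtomisticToContinuum.Crystallization.Theorems.FrustratedLawDichotomyStrainedPatchRobustRows
open Summit.AtomisticToContinuum.Crystallization.Theorems.FrustratedLawDichotomyStrainedPatchStretchRows

/-! ## §1. Texture profiles: law, certificate, bridge -/

/-- The TEXTURE-PROFILE predicate of one chart: at every reach site `a` of the charted ball and every move-test neighbour `b` of `a` inside the ball,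
relative texture `relTex a b ≤ μ (dist (z a) (z c))` — a radial profile instead of 66R's constant `m` / 67S's step. -/
def TexProfile {M : ℕ} (z : Fin M → E3) (c : Fin M) {M₀ : ℕ} (z₀ : Fin M₀ → E3) (c₀ : Fin M₀) (e : Fin M → Fin M₀) (μ : ℝ → ℝ) : Prop :=
  ∀ a ∈ ball (63 / 10) z c, IsReach z c a → ∀ b ∈ moveNbrs 7 z a, b ∈ ball (63 / 10) z c → relTex z c z₀ c₀ e a b ≤ μ (dist (z a) (z c))

/-- ★ **(LOC∇ μ) `RelTextureProfile 𝓘 τ μ`** [ASYMPTOTIC-REGIME THEOREM · PROVED for `μ ≥ 2τ` (`relTextureProfile_of_two_tau_le`) · REFUTED BY WITNESS for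
`μ ≤ m` on `[0, ρ]` whenever `TextureWitness 𝓘 τ ρ m` (§2); instrument: `m ≈ 0.6 τ` at `ρ = 1`, record geometry] — admissible clean mono-phase clusters
`τ`-charted by an instance of `𝓘` have relative texture profile `μ`. -/
def RelTextureProfile (𝓘 : ChartFam) (τ : ℝ) (μ : ℝ → ℝ) : Prop :=
  ∀ (M : ℕ) (z : Fin M → E3) (c : Fin M) (M₀ : ℕ) (z₀ : Fin M₀ → E3) (c₀ : Fin M₀) (e : Fin M → Fin M₀),
    Admissible M z c → CleanBall (63 / 10) z c → MonoPhaseBall (63 / 10) z c → ChartBy 𝓘 τ τ z c z₀ c₀ e → TexProfile z c z₀ c₀ e μ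

/-- ★ **(FT∇ μ) `RobustTubeCertProfile 𝓘 τ μ`** [FINITE RANGE · INSTRUMENTABLE — 66R's sound row format with the remainder functional priced at the local
texture `μ(dist(z a, z c))` per row; the census's graded certificates live here] — the tube floor restricted to charts of texture profile `μ`. -/
def RobustTubeCertProfile (𝓘 : ChartFam) (τ : ℝ) (μ : ℝ → ℝ) : Prop :=
  ∀ (M : ℕ) (z : Fin M → E3) (c : Fin M) (M₀ : ℕ) (z₀ : Fin M₀ → E3) (c₀ : Fin M₀) (e : Fin M → Fin M₀),
    Admissible M z c → CleanBall (63 / 10) z c → MonoPhaseBall (63 / 10) z c → ChartBy 𝓘 τ τ z c z₀ c₀ e → TexProfile z c z₀ c₀ e μ →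
      0 ≤ ballAvg (9 / 5) z (xRec M z) c

/-- ★★ **THE PROFILE BRIDGE** — (LOC∇ μ) ∧ (FT∇ μ) ⟹ (TF). [formal bookkeeping] -/
theorem tubeFloor_of_relTextureProfile_of_certProfile {𝓘 : ChartFam} {τ : ℝ} {μ : ℝ → ℝ} (hL : RelTextureProfile 𝓘 τ μ)
    (hC : RobustTubeCertProfile 𝓘 τ μ) : TubeFloor 𝓘 τ :=
  fun M z c M₀ z₀ c₀ e hz hcl hmo hch => hC M z c M₀ z₀ c₀ e hz hcl hmo hch (hL M z c M₀ z₀ c₀ e hz hcl hmo hch)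

/-- Conversely the tube floor is the profile certificate at every profile. [formal bookkeeping] -/
theorem certProfile_of_tubeFloor {𝓘 : ChartFam} {τ : ℝ} (h : TubeFloor 𝓘 τ) (μ : ℝ → ℝ) : RobustTubeCertProfile 𝓘 τ μ :=
  fun M z c M₀ z₀ c₀ e hz hcl hmo hch _ => h M z c M₀ z₀ c₀ e hz hcl hmo hch

/-- A pointwise-larger profile on `[0, 63/10]` is a weaker texture predicate. [formal bookkeeping] -/
theorem TexProfile.mono {M : ℕ} {z : Fin M → E3} {c : Fin M} {M₀ : ℕ} {z₀ : Fin M₀ → E3} {c₀ : Fin M₀} {e : Fin M → Fin M₀} {μ μ' : ℝ → ℝ}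
    (h : TexProfile z c z₀ c₀ e μ) (hle : ∀ x : ℝ, 0 ≤ x → x ≤ 63 / 10 → μ x ≤ μ' x) : TexProfile z c z₀ c₀ e μ' :=
  fun a ha hr b hb hb' => (h a ha hr b hb hb').trans (hle _ dist_nonneg (mem_ball.1 ha))

/-- (LOC∇ μ) is monotone in the profile (upward on `[0, 63/10]`). [formal bookkeeping] -/
theorem RelTextureProfile.mono {𝓘 : ChartFam} {τ : ℝ} {μ μ' : ℝ → ℝ} (h : RelTextureProfile 𝓘 τ μ)
    (hle : ∀ x : ℝ, 0 ≤ x → x ≤ 63 / 10 → μ x ≤ μ' x) : RelTextureProfile 𝓘 τ μ' :=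
  fun M z c M₀ z₀ c₀ e hz hcl hmo hch => (h M z c M₀ z₀ c₀ e hz hcl hmo hch).mono hle

/-- (FT∇ μ) is antitone in the profile (a certificate valid up to `μ'` is valid up to any pointwise-smaller `μ`). [formal bookkeeping] -/
theorem RobustTubeCertProfile.anti {𝓘 : ChartFam} {τ : ℝ} {μ μ' : ℝ → ℝ} (h : RobustTubeCertProfile 𝓘 τ μ')
    (hle : ∀ x : ℝ, 0 ≤ x → x ≤ 63 / 10 → μ x ≤ μ' x) : RobustTubeCertProfile 𝓘 τ μ :=
  fun M z c M₀ z₀ c₀ e hz hcl hmo hch hμ => h M z c M₀ z₀ c₀ e hz hcl hmo hch (hμ.mono hle)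

/-- (LOC∇ μ) restricts along sub-families. [formal bookkeeping] -/
theorem RelTextureProfile.anti_family {𝓘 𝓘' : ChartFam} (hle : ∀ M₀ z₀ c₀, 𝓘 M₀ z₀ c₀ → 𝓘' M₀ z₀ c₀) {τ : ℝ} {μ : ℝ → ℝ}
    (h : RelTextureProfile 𝓘' τ μ) : RelTextureProfile 𝓘 τ μ :=
  fun M z c M₀ z₀ c₀ e hz hcl hmo hch => h M z c M₀ z₀ c₀ e hz hcl hmo ⟨hle _ _ _ hch.1, hch.2⟩

/-- (FT∇ μ) restricts along sub-families. [formal bookkeeping] -/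
theorem RobustTubeCertProfile.anti_family {𝓘 𝓘' : ChartFam} (hle : ∀ M₀ z₀ c₀, 𝓘 M₀ z₀ c₀ → 𝓘' M₀ z₀ c₀) {τ : ℝ} {μ : ℝ → ℝ}
    (h : RobustTubeCertProfile 𝓘' τ μ) : RobustTubeCertProfile 𝓘 τ μ :=
  fun M z c M₀ z₀ c₀ e hz hcl hmo hch => h M z c M₀ z₀ c₀ e hz hcl hmo ⟨hle _ _ _ hch.1, hch.2⟩

/-- The CONSTANT profile is 66R's (LOC∇ m). [formal bookkeeping] -/
theorem relTextureProfile_const_iff (𝓘 : ChartFam) (τ m : ℝ) : RelTextureProfile 𝓘 τ (fun _ => m) ↔ RelTexture 𝓘 τ m := Iff.rfl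

/-- The CONSTANT profile certificate is 66R's (FT∇ m). [formal bookkeeping] -/
theorem certProfile_const_iff (𝓘 : ChartFam) (τ m : ℝ) : RobustTubeCertProfile 𝓘 τ (fun _ => m) ↔ RobustTubeCert 𝓘 τ m := Iff.rfl

/-- ★ **(LOC∇ μ) PROVED in the a-priori regime `μ ≥ 2τ` on `[0, 63/10]`** (from 66R's `relTexture_two_tau`). -/
theorem relTextureProfile_of_two_tau_le (𝓘 : ChartFam) (τ : ℝ) {μ : ℝ → ℝ} (hμ : ∀ x : ℝ, 0 ≤ x → x ≤ 63 / 10 → 2 * τ ≤ μ x) :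
    RelTextureProfile 𝓘 τ μ :=
  ((relTextureProfile_const_iff 𝓘 τ (2 * τ)).2 (relTexture_two_tau 𝓘 τ)).mono fun x h0 h1 => hμ x h0 h1

/-- At the a-priori profile the split is not a split: (FT∇ 2τ-profile) ⟹ (TF). [formal bookkeeping] -/
theorem tubeFloor_of_certProfile_two_tau {𝓘 : ChartFam} {τ : ℝ} {μ : ℝ → ℝ} (hμ : ∀ x : ℝ, 0 ≤ x → x ≤ 63 / 10 → 2 * τ ≤ μ x)
    (hC : RobustTubeCertProfile 𝓘 τ μ) : TubeFloor 𝓘 τ :=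
  tubeFloor_of_relTextureProfile_of_certProfile (relTextureProfile_of_two_tau_le 𝓘 τ hμ) hC

/-- A profile `≤ m` on `[0, r]` (`r ≤ 63/10`) controls 67S's inner texture `TexIn r m` (the step profile is STRONGER than 67S: it bounds bonds leaving
`ball r` too). [formal bookkeeping] -/
theorem texIn_of_texProfile {M : ℕ} {z : Fin M → E3} {c : Fin M} {M₀ : ℕ} {z₀ : Fin M₀ → E3} {c₀ : Fin M₀} {e : Fin M → Fin M₀} {μ : ℝ → ℝ}
    {r m : ℝ} (h : TexProfile z c z₀ c₀ e μ) (hr : r ≤ 63 / 10) (hμ : ∀ x : ℝ, 0 ≤ x → x ≤ r → μ x ≤ m) : TexIn z c z₀ c₀ e r m :=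
  fun a ha hra b hb hb' => (h a (mem_ball_of_le hr ha) hra b hb (mem_ball_of_le hr hb')).trans (hμ _ dist_nonneg (mem_ball.1 ha))

/-- (LOC∇ μ) with `μ ≤ m` on `[0, r]` ⟹ 67S's (LOC∇ᵢₙ r m). [formal bookkeeping] -/
theorem relTextureIn_of_relTextureProfile {𝓘 : ChartFam} {τ : ℝ} {μ : ℝ → ℝ} {r m : ℝ} (h : RelTextureProfile 𝓘 τ μ) (hr : r ≤ 63 / 10)
    (hμ : ∀ x : ℝ, 0 ≤ x → x ≤ r → μ x ≤ m) : RelTextureIn 𝓘 τ r m :=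
  fun M z c M₀ z₀ c₀ e hz hcl hmo hch => texIn_of_texProfile (h M z c M₀ z₀ c₀ e hz hcl hmo hch) hr hμ

/-- 67S's inner certificate (FT∇ᵢₙ r m) ⟹ (FT∇ μ) for every profile `μ ≤ m` on `[0, r]`. [formal bookkeeping] -/
theorem certProfile_of_certIn {𝓘 : ChartFam} {τ : ℝ} {μ : ℝ → ℝ} {r m : ℝ} (hC : RobustTubeCertIn 𝓘 τ r m) (hr : r ≤ 63 / 10)
    (hμ : ∀ x : ℝ, 0 ≤ x → x ≤ r → μ x ≤ m) : RobustTubeCertProfile 𝓘 τ μ :=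
  fun M z c M₀ z₀ c₀ e hz hcl hmo hch hT => hC M z c M₀ z₀ c₀ e hz hcl hmo hch (texIn_of_texProfile hT hr hμ)

/-- ★★ **RECORD JUNCTION** — a profile law and a profile certificate for the record family `FamP` at `τ = 1/80`, with the cover `CoverP`, give the
[CORE-FAR] conclusion `CoreOffTubeFloor (63/10) (63/10) (24/5) (1/100) 0` (via `coreOff_record_of_tubeP_of_coverP`). [formal bookkeeping] -/
theorem coreOff_record_of_profile {μ : ℝ → ℝ} (hL : RelTextureProfile FamP (1 / 80) μ) (hC : RobustTubeCertProfile FamP (1 / 80) μ) (hCov : CoverP) :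
    CoreOffTubeFloor (63 / 10) (63 / 10) (24 / 5) (1 / 100) 0 :=
  coreOff_record_of_tubeP_of_coverP (tubeFloor_of_relTextureProfile_of_certProfile hL hC) hCov

/-! ## §2. The texture floor: witnesses refute laws -/

/-- ★ **`TextureWitness 𝓘 τ ρ m`** [REFUTATION FORMAT] — there is an admissible `63/10`-clean `63/10`-mono-phase cluster, `τ`-charted by an instance of `𝓘`,
with a reach site `a` at depth `dist (z a) (z c) ≤ ρ` and a move-test neighbour `b` inside the ball of relative texture `> m`.
INSTRUMENT (MEASURED, not proved; `nlwit.py`, model = HE52 host, identity chart, LJ forces with cutoff 7, exterior pattern `|U| ≤ τ`, interior relaxed to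
`max ‖siteForce 7‖ ≤ 3.9·10⁻⁵ = σ₁/278`, all atoms within `τ = 1/80` of the chart): `ρ = 1`, `m = 0.606 τ`; by midpoint radius `0–4`: `0.58–0.62 τ`;
`4.5–6`: `0.68–1.06 τ`.  Admissibility fine print (`¬TightNearCap`, `¬ExemptNear`, `¬BadNearCap` for `τ`-perturbations of HE52) is the census's to confirm. -/
def TextureWitness (𝓘 : ChartFam) (τ ρ m : ℝ) : Prop :=
  ∃ (M : ℕ) (z : Fin M → E3) (c : Fin M) (M₀ : ℕ) (z₀ : Fin M₀ → E3) (c₀ : Fin M₀) (e : Fin M → Fin M₀),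
    Admissible M z c ∧ CleanBall (63 / 10) z c ∧ MonoPhaseBall (63 / 10) z c ∧ ChartBy 𝓘 τ τ z c z₀ c₀ e ∧
      ∃ a ∈ ball (63 / 10) z c, IsReach z c a ∧ dist (z a) (z c) ≤ ρ ∧ ∃ b ∈ moveNbrs 7 z a, b ∈ ball (63 / 10) z c ∧ m < relTex z c z₀ c₀ e a b

/-- ★★ **A WITNESS REFUTES EVERY PROFILE LAW BELOW IT**: `TextureWitness 𝓘 τ ρ m` and `μ ≤ m` on `[0, ρ]` ⟹ ¬(LOC∇ μ). [formal bookkeeping] -/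
theorem not_relTextureProfile_of_witness {𝓘 : ChartFam} {τ ρ m : ℝ} {μ : ℝ → ℝ} (hW : TextureWitness 𝓘 τ ρ m)
    (hμ : ∀ x : ℝ, 0 ≤ x → x ≤ ρ → μ x ≤ m) : ¬ RelTextureProfile 𝓘 τ μ := by
  rintro hL
  obtain ⟨M, z, c, M₀, z₀, c₀, e, hz, hcl, hmo, hch, a, ha, hra, hρ, b, hb, hb', hlt⟩ := hW
  have h1 := hL M z c M₀ z₀ c₀ e hz hcl hmo hch a ha hra b hb hb'
  exact absurd (h1.trans (hμ _ dist_nonneg hρ)) (not_le.2 hlt)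

/-- Equivalently: a law that survives a witness EXCEEDS the witnessed level somewhere on `[0, ρ]` — the profile a certificate must then be priced at.
[formal bookkeeping] -/
theorem exists_gt_of_relTextureProfile_of_witness {𝓘 : ChartFam} {τ ρ m : ℝ} {μ : ℝ → ℝ} (hL : RelTextureProfile 𝓘 τ μ)
    (hW : TextureWitness 𝓘 τ ρ m) : ∃ x : ℝ, 0 ≤ x ∧ x ≤ ρ ∧ m < μ x := by
  by_contra h
  exact not_relTextureProfile_of_witness hW (fun x h0 h1 => not_lt.1 fun hlt => h ⟨x, h0, h1, hlt⟩) hL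

/-- ★★ In particular a witness at any depth refutes 66R's constant law: `TextureWitness 𝓘 τ ρ m ⟹ ¬ RelTexture 𝓘 τ m`. [formal bookkeeping] -/
theorem not_relTexture_of_witness {𝓘 : ChartFam} {τ ρ m : ℝ} (hW : TextureWitness 𝓘 τ ρ m) : ¬ RelTexture 𝓘 τ m := fun hL =>
  not_relTextureProfile_of_witness (μ := fun _ => m) hW (fun _ _ _ => le_rfl) ((relTextureProfile_const_iff 𝓘 τ m).2 hL)

/-- Every valid constant law lies STRICTLY ABOVE every witnessed texture. [formal bookkeeping] -/
theorem lt_of_relTexture_of_witness {𝓘 : ChartFam} {τ ρ m m' : ℝ} (hL : RelTexture 𝓘 τ m') (hW : TextureWitness 𝓘 τ ρ m) : m < m' := by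
  by_contra h
  exact not_relTexture_of_witness hW (hL.mono (not_lt.1 h))

/-- Witnesses are downward closed in the texture level. [formal bookkeeping] -/
theorem TextureWitness.anti {𝓘 : ChartFam} {τ ρ m m' : ℝ} (hW : TextureWitness 𝓘 τ ρ m) (hle : m' ≤ m) : TextureWitness 𝓘 τ ρ m' := by
  obtain ⟨M, z, c, M₀, z₀, c₀, e, hz, hcl, hmo, hch, a, ha, hra, hρ, b, hb, hb', hlt⟩ := hW
  exact ⟨M, z, c, M₀, z₀, c₀, e, hz, hcl, hmo, hch, a, ha, hra, hρ, b, hb, hb', hle.trans_lt hlt⟩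

/-- Witnesses are upward closed in the depth. [formal bookkeeping] -/
theorem TextureWitness.mono_depth {𝓘 : ChartFam} {τ ρ ρ' m : ℝ} (hW : TextureWitness 𝓘 τ ρ m) (hle : ρ ≤ ρ') : TextureWitness 𝓘 τ ρ' m := by
  obtain ⟨M, z, c, M₀, z₀, c₀, e, hz, hcl, hmo, hch, a, ha, hra, hρ, b, hb, hb', hlt⟩ := hW
  exact ⟨M, z, c, M₀, z₀, c₀, e, hz, hcl, hmo, hch, a, ha, hra, hρ.trans hle, b, hb, hb', hlt⟩

/-- Witnesses persist along family ENLARGEMENT (a chart by an instance of `𝓘` is a chart by an instance of any `𝓘' ⊇ 𝓘`). [formal bookkeeping] -/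
theorem TextureWitness.mono_family {𝓘 𝓘' : ChartFam} (hle : ∀ M₀ z₀ c₀, 𝓘 M₀ z₀ c₀ → 𝓘' M₀ z₀ c₀) {τ ρ m : ℝ} (hW : TextureWitness 𝓘 τ ρ m) :
    TextureWitness 𝓘' τ ρ m := by
  obtain ⟨M, z, c, M₀, z₀, c₀, e, hz, hcl, hmo, hch, a, ha, hra, hρ, b, hb, hb', hlt⟩ := hW
  exact ⟨M, z, c, M₀, z₀, c₀, e, hz, hcl, hmo, ⟨hle _ _ _ hch.1, hch.2⟩, a, ha, hra, hρ, b, hb, hb', hlt⟩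

/-- Consistency with the a-priori regime: a witnessed texture is `< 2τ`. [formal bookkeeping] -/
theorem lt_two_tau_of_witness {𝓘 : ChartFam} {τ ρ m : ℝ} (hW : TextureWitness 𝓘 τ ρ m) : m < 2 * τ :=
  lt_of_relTexture_of_witness (relTexture_two_tau 𝓘 τ) hW

/-- ★ **THE DICHOTOMY THE CENSUS MUST PRICE** — for every level `m`, either the constant law (LOC∇ m) holds (and then the texture-priced certificate may use
`m`), or there is NO witness-free way below `m`: a witness at level `m` forces every usable certificate to be valid at some `m' > m`, i.e. (FT∇ m') with
`m' > m` is then the only certificate that can meet a law.  [formal bookkeeping: `TubeFloor` from a law/certificate pair above a witness.] -/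
theorem tubeFloor_of_pair_above_witness {𝓘 : ChartFam} {τ ρ m m' : ℝ} (hW : TextureWitness 𝓘 τ ρ m) (hL : RelTexture 𝓘 τ m')
    (hC : RobustTubeCert 𝓘 τ m') : m < m' ∧ TubeFloor 𝓘 τ :=
  ⟨lt_of_relTexture_of_witness hL hW, tubeFloor_of_relTexture_of_robustCert hL hC⟩

/-- **`TextureFloorClaimP`** [INSTRUMENT CLAIM · MEASURED, NOT PROVED · model caveats in the docstring of `TextureWitness`] — the record family at
`τ = 1/80` admits a texture witness of level `7/1000 (= 0.56 τ)` at depth `1`: the typed form of the g70 measurement (`0.606 τ` at the central bond).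
Its consequence `¬ RelTexture FamP (1/80) (7/1000)` (next lemma) closes the texture rescue of the record kernel, whose bar is `m⋆ ≈ 0.28 τ = 7/2000`. -/
def TextureFloorClaimP : Prop := TextureWitness FamP (1 / 80) 1 (7 / 1000)

/-- The instrument claim kills every record law at or below `0.56 τ`. [formal bookkeeping] -/
theorem not_relTexture_record_of_claim (h : TextureFloorClaimP) {m : ℝ} (hm : m ≤ 7 / 1000) : ¬ RelTexture FamP (1 / 80) m :=
  not_relTexture_of_witness (h.anti hm)

/-- **`TextureFloorClaimP7`** [INSTRUMENT CLAIM · MEASURED, NOT PROVED] — the SAME witness read with the law's own quantifier `b ∈ moveNbrs 7`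
(ALL neighbours within distance 7, not only nearest neighbours): at depth `≤ 9/2` some pair `(a, b)` with `dist ≤ 7`, both in the ball, has relative
texture `≥ 1.88 τ > 23/1000 (= 1.84 τ)` (`remdiag.py`, column `tex7`).  As typed, (LOC∇ m) therefore has essentially no room below the a-priori `2τ`. -/
def TextureFloorClaimP7 : Prop := TextureWitness FamP (1 / 80) (9 / 2) (23 / 1000)

/-- The range-7 reading kills every record law at or below `1.84 τ = 0.92 · 2τ`. [formal bookkeeping] -/
theorem not_relTexture_record_of_claim7 (h : TextureFloorClaimP7) {m : ℝ} (hm : m ≤ 23 / 1000) : ¬ RelTexture FamP (1 / 80) m :=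
  not_relTexture_of_witness (h.anti hm)

/-- Under the range-7 claim the only constant-texture certificates that can still meet a law are those valid above `0.92 · 2τ` — within 8 % of the
a-priori certificate (FT∇ 2τ) = (TF) itself (`robustTubeCert_two_tau_iff` in 66R). [formal bookkeeping] -/
theorem lt_of_relTexture_record_of_claim7 (h : TextureFloorClaimP7) {m : ℝ} (hL : RelTexture FamP (1 / 80) m) : 23 / 1000 < m :=
  lt_of_relTexture_of_witness hL h

/-! ## §3. The ℓ²-format: INTERIOR TEXTURE-ENERGY LAW and the LAW-ASSISTED CERTIFICATE (critic row 1177's leaf `InteriorTextureLaw θ ρ_int`)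

Census AUG-63 prices a force row `a` not by its sup-texture but by a TEXTURE ENERGY `E_a(w) = Σ_b Δ_abᵀ M̂_b Δ_ab` (per-bond quadratic ENVELOPE of the exact
second-order force remainder; ISO `M̂ = ½α I`, SPLIT `α x̂x̂ᵀ + γ(I − x̂x̂ᵀ)`), and the missing statement of record is «`E_a(w) ≤ θ·Ē_a` on the feasible set,
interior rows `R₀ ≤ ρ_int`» (θ*₁₅ < 0.02 at 1/80).  We type it PARAMETRICALLY: the per-bond form `q : E3 → E3 → ℝ` (host bond vector, relative deviation) ↦
charge, the neighbour radius `r` (census: 23/10), the interior radius `ρ`, and a row BUDGET `B M₀ z₀ a₀` (= θ·Ē at the instance row) are arguments; partners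
range over the charted `63/10`-ball (exterior partners are uncharted, see §2's docstring and memo §3c). -/

/-- Row budgets `B M₀ z₀ a₀` (census: `θ · Ē_a` at the instance row). -/
abbrev TexBudget := (M₀ : ℕ) → (Fin M₀ → E3) → Fin M₀ → ℝ

/-- Census's ISO envelope form `q d Δ = α(‖d‖)·‖Δ‖²`. -/
noncomputable def isoForm (α : ℝ → ℝ) (d Δ : E3) : ℝ := α ‖d‖ * ‖Δ‖ ^ 2

/-- Census's SPLIT envelope form `q d Δ = α(‖d‖)·⟪d/‖d‖, Δ⟫² + γ(‖d‖)·(‖Δ‖² − ⟪d/‖d‖, Δ⟫²)` (67sr). -/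
noncomputable def splitForm (α γ : ℝ → ℝ) (d Δ : E3) : ℝ :=
  α ‖d‖ * (⟪(‖d‖⁻¹) • d, Δ⟫) ^ 2 + γ ‖d‖ * (‖Δ‖ ^ 2 - (⟪(‖d‖⁻¹) • d, Δ⟫) ^ 2)

/-- **TEXTURE ENERGY of row `a`** in the chart `(z₀, c₀, e)`: `Σ_{b ∈ ball 63/10, b ≠ a, host distance < r} q (z₀(e b) − z₀(e a)) (dev b − dev a)`. -/
noncomputable def texEnergy (q : E3 → E3 → ℝ) (r : ℝ) {M : ℕ} (z : Fin M → E3) (c : Fin M) {M₀ : ℕ} (z₀ : Fin M₀ → E3) (c₀ : Fin M₀)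
    (e : Fin M → Fin M₀) (a : Fin M) : ℝ :=
  ∑ b ∈ (ball (63 / 10) z c).filter (fun b => b ≠ a ∧ dist (z₀ (e b)) (z₀ (e a)) < r),
    q (z₀ (e b) - z₀ (e a)) (dev z c z₀ c₀ e b - dev z c z₀ c₀ e a)

/-- ★★ **(LOC∇)ℓ² `InteriorTexLaw 𝓘 τ q r ρ B`** [ASYMPTOTIC-REGIME THEOREM · ANALYTIC · LOAD-BEARING (critic 1177) · MEASURED FROM BELOW (memo §3c)] — every
admissible clean mono-phase cluster `τ`-charted by an instance of `𝓘` has texture energy `≤ B(z₀, e a)` at every reach row `a` of depth `≤ ρ`. -/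
def InteriorTexLaw (𝓘 : ChartFam) (τ : ℝ) (q : E3 → E3 → ℝ) (r ρ : ℝ) (B : TexBudget) : Prop :=
  ∀ (M : ℕ) (z : Fin M → E3) (c : Fin M) (M₀ : ℕ) (z₀ : Fin M₀ → E3) (c₀ : Fin M₀) (e : Fin M → Fin M₀),
    Admissible M z c → CleanBall (63 / 10) z c → MonoPhaseBall (63 / 10) z c → ChartBy 𝓘 τ τ z c z₀ c₀ e →
      ∀ a ∈ ball ρ z c, IsReach z c a → texEnergy q r z c z₀ c₀ e a ≤ B M₀ z₀ (e a)

/-- ★★ **`LawAssistedCert 𝓘 τ q r ρ B`** [FINITE RANGE · INSTRUMENTABLE (census SPL/θ-ladder format)] — the tube floor RESTRICTED to charts obeying the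
texture-energy budget on the interior rows: what a law-assisted sound certificate (chord slope `2σ₁' + B`) certifies per cell. -/
def LawAssistedCert (𝓘 : ChartFam) (τ : ℝ) (q : E3 → E3 → ℝ) (r ρ : ℝ) (B : TexBudget) : Prop :=
  ∀ (M : ℕ) (z : Fin M → E3) (c : Fin M) (M₀ : ℕ) (z₀ : Fin M₀ → E3) (c₀ : Fin M₀) (e : Fin M → Fin M₀),
    Admissible M z c → CleanBall (63 / 10) z c → MonoPhaseBall (63 / 10) z c → ChartBy 𝓘 τ τ z c z₀ c₀ e →
      (∀ a ∈ ball ρ z c, IsReach z c a → texEnergy q r z c z₀ c₀ e a ≤ B M₀ z₀ (e a)) → 0 ≤ ballAvg (9 / 5) z (xRec M z) c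

/-- ★★ **THE SEAM** «law ∧ law-assisted certificate ⇒ tube floor». [formal bookkeeping] -/
theorem tubeFloor_of_texLaw_of_lawCert {𝓘 : ChartFam} {τ : ℝ} {q : E3 → E3 → ℝ} {r ρ : ℝ} {B : TexBudget}
    (hL : InteriorTexLaw 𝓘 τ q r ρ B) (hC : LawAssistedCert 𝓘 τ q r ρ B) : TubeFloor 𝓘 τ :=
  fun M z c M₀ z₀ c₀ e hA hcl hmp hch => hC M z c M₀ z₀ c₀ e hA hcl hmp hch (hL M z c M₀ z₀ c₀ e hA hcl hmp hch)

/-- The law-assisted certificate is implied by the tube floor (it is (TF) with an extra hypothesis). [formal bookkeeping] -/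
theorem lawCert_of_tubeFloor {𝓘 : ChartFam} {τ : ℝ} (q : E3 → E3 → ℝ) (r ρ : ℝ) (B : TexBudget) (h : TubeFloor 𝓘 τ) :
    LawAssistedCert 𝓘 τ q r ρ B :=
  fun M z c M₀ z₀ c₀ e hA hcl hmp hch _ => h M z c M₀ z₀ c₀ e hA hcl hmp hch

/-- The law is MONOTONE in the budget. [formal bookkeeping] -/
theorem InteriorTexLaw.mono {𝓘 : ChartFam} {τ : ℝ} {q : E3 → E3 → ℝ} {r ρ : ℝ} {B B' : TexBudget}
    (hB : ∀ M₀ z₀ a₀, B M₀ z₀ a₀ ≤ B' M₀ z₀ a₀) (h : InteriorTexLaw 𝓘 τ q r ρ B) : InteriorTexLaw 𝓘 τ q r ρ B' :=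
  fun M z c M₀ z₀ c₀ e hA hcl hmp hch a ha hr => (h M z c M₀ z₀ c₀ e hA hcl hmp hch a ha hr).trans (hB M₀ z₀ (e a))

/-- The certificate is ANTITONE in the budget. [formal bookkeeping] -/
theorem LawAssistedCert.anti {𝓘 : ChartFam} {τ : ℝ} {q : E3 → E3 → ℝ} {r ρ : ℝ} {B B' : TexBudget}
    (hB : ∀ M₀ z₀ a₀, B M₀ z₀ a₀ ≤ B' M₀ z₀ a₀) (h : LawAssistedCert 𝓘 τ q r ρ B') : LawAssistedCert 𝓘 τ q r ρ B :=
  fun M z c M₀ z₀ c₀ e hA hcl hmp hch hlaw => h M z c M₀ z₀ c₀ e hA hcl hmp hch fun a ha hr => (hlaw a ha hr).trans (hB M₀ z₀ (e a))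

/-- The law is ANTITONE in the interior radius. [formal bookkeeping] -/
theorem InteriorTexLaw.anti_radius {𝓘 : ChartFam} {τ : ℝ} {q : E3 → E3 → ℝ} {r ρ ρ' : ℝ} {B : TexBudget} (hρ : ρ' ≤ ρ)
    (h : InteriorTexLaw 𝓘 τ q r ρ B) : InteriorTexLaw 𝓘 τ q r ρ' B :=
  fun M z c M₀ z₀ c₀ e hA hcl hmp hch a ha hr => h M z c M₀ z₀ c₀ e hA hcl hmp hch a (mem_ball_of_le hρ ha) hr

/-- The law is ANTITONE in the chart family. [formal bookkeeping] -/
theorem InteriorTexLaw.anti_family {𝓘 𝓘' : ChartFam} {τ : ℝ} {q : E3 → E3 → ℝ} {r ρ : ℝ} {B : TexBudget}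
    (hsub : ∀ M₀ z₀ c₀, 𝓘 M₀ z₀ c₀ → 𝓘' M₀ z₀ c₀) (h : InteriorTexLaw 𝓘' τ q r ρ B) : InteriorTexLaw 𝓘 τ q r ρ B :=
  fun M z c M₀ z₀ c₀ e hA hcl hmp hch => h M z c M₀ z₀ c₀ e hA hcl hmp ⟨hsub _ _ _ hch.1, hch.2⟩

/-- **RECORD JUNCTION (ℓ² format)**: law ∧ law-assisted certificate ∧ cover ⇒ [CORE-FAR] at τ = 1/80. [formal bookkeeping] -/
theorem coreOff_record_of_texLaw {q : E3 → E3 → ℝ} {r ρ : ℝ} {B : TexBudget} (hL : InteriorTexLaw FamP (1 / 80) q r ρ B)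
    (hC : LawAssistedCert FamP (1 / 80) q r ρ B) (hCov : CoverP) : CoreOffTubeFloor (63 / 10) (63 / 10) (24 / 5) (1 / 100) 0 :=
  coreOff_record_of_tubeP_of_coverP (tubeFloor_of_texLaw_of_lawCert hL hC) hCov

/-- ★ **TEXTURE-ENERGY WITNESS** [INSTRUMENT-FED REFUTATION FORMAT, ℓ² currency]: an admissible charted cluster with a reach row of depth `≤ ρ` whose texture
energy exceeds its budget.  Memo §3c: exterior-driven witnesses give, in census's ISO currency, `E_a/Ē_a = 0.026–0.054` on the core bands `R₀ ≤ 4` at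
R = 63/10 (census threshold θ*₁₅ < 0.02; census's own exterior-FIXED sample ≤ 0.0031). -/
def TexEnergyWitness (𝓘 : ChartFam) (τ : ℝ) (q : E3 → E3 → ℝ) (r ρ : ℝ) (B : TexBudget) : Prop :=
  ∃ (M : ℕ) (z : Fin M → E3) (c : Fin M) (M₀ : ℕ) (z₀ : Fin M₀ → E3) (c₀ : Fin M₀) (e : Fin M → Fin M₀),
    Admissible M z c ∧ CleanBall (63 / 10) z c ∧ MonoPhaseBall (63 / 10) z c ∧ ChartBy 𝓘 τ τ z c z₀ c₀ e ∧
      ∃ a ∈ ball ρ z c, IsReach z c a ∧ B M₀ z₀ (e a) < texEnergy q r z c z₀ c₀ e a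

/-- A texture-energy witness refutes the law at its budget (and, by `InteriorTexLaw.mono`, at every smaller budget). [formal bookkeeping] -/
theorem not_texLaw_of_witness {𝓘 : ChartFam} {τ : ℝ} {q : E3 → E3 → ℝ} {r ρ : ℝ} {B : TexBudget} (hW : TexEnergyWitness 𝓘 τ q r ρ B) :
    ¬ InteriorTexLaw 𝓘 τ q r ρ B := by
  intro hL
  obtain ⟨M, z, c, M₀, z₀, c₀, e, hA, hcl, hmp, hch, a, ha, hr, hlt⟩ := hW
  exact absurd (hL M z c M₀ z₀ c₀ e hA hcl hmp hch a ha hr) (not_le.2 hlt)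

/-- Conversely a law bounds every witness's energy: under the law, a witness at budget `B` forces `B < B'` somewhere is impossible — stated as: law at `B'`
and witness at `B` give a row with `B(z₀, a₀) < B'(z₀, a₀)`. [formal bookkeeping] -/
theorem exists_lt_of_texLaw_of_witness {𝓘 : ChartFam} {τ : ℝ} {q : E3 → E3 → ℝ} {r ρ : ℝ} {B B' : TexBudget}
    (hL : InteriorTexLaw 𝓘 τ q r ρ B') (hW : TexEnergyWitness 𝓘 τ q r ρ B) : ∃ (M₀ : ℕ) (z₀ : Fin M₀ → E3) (a₀ : Fin M₀), B M₀ z₀ a₀ < B' M₀ z₀ a₀ := by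
  obtain ⟨M, z, c, M₀, z₀, c₀, e, hA, hcl, hmp, hch, a, ha, hr, hlt⟩ := hW
  exact ⟨M₀, z₀, e a, lt_of_lt_of_le hlt (hL M z c M₀ z₀ c₀ e hA hcl hmp hch a ha hr)⟩

end Summit.AtomisticToContinuum.Crystallization.Theorems.FrustratedLawDichotomyStrainedPatchTextureFloor
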